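import Summits.QuantumFields.BalabanUV.Beta.GAN24.DerivativeRateTransferLoewnerKKT

/-!
# `BalabanUV.Beta.GAN24.DerivativeRateTransferLoewnerGram` — binder row G-an2-4 ∕ (CONV-C), route R6 «VALUES, NOT DERIVATIVES», PART 20:
# THE LOEWNER REDUCTION UNDER AN ADDITIVE GRAM SLACK — (STAB) only up to `(1 + ε)·H′ + δ·G` (the shape a CURVED background produces: the
# covariant Jensen inequality for transported block averages holds up to a factor AND a mass term `δ·G`, `δ = O(curvature²)`), and the
# effective-form one-step rate survives with the slack entering ADDITIVELY through the `G`-mass of the unit-source minimisers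
# (unit b2b-balaban-gan24-p3, gen 37; v1.1 = v1 + the PRICING HANDLES paragraph asked by gan24-idea-1 g37; code byte-identical)

NOT IN PRINT; OUR PROOF (for the ROUTE; [folklore] finite-dimensional linear algebra — PART 18's bordered letters BY NAME
(`dotProduct_effForm_le_trial`, `dotProduct_effForm_eq_energy`, `mulVec_minOp`, `effForm_step_diag_le_cons`, `leg_energy_eq_cons_sub_step`,
`abs_apply_le_of_diag_le`)).  HONEST FRAMING (cell contract, verbatim): «discharging `BetaPertH` makes Bałaban's UV stability UNCONDITIONAL — a real
constructive-QFT result; it is NOT the continuum limit and NOT the Clay problem.»  HONEST DEPENDENCY (verbatim): «continuum YM on T⁴ ⇐ BetaPertH ∧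
nine spine estimates (0/9 proved); BetaPertH ⇐ (D1) ∧ (D4) ∧ CAP+tail; G-an2-4 gates asym, D1 and NE2/3/4.»

WHY THIS FILE.  Route R6's debt of record (ROUTES-GAN24 v36 §2 R6; `HOME/b2b-balaban-gan24-p3/gen36/R6-LOEWNER-NOTE.md` §2) begins with (STAB)(s,t):
«one covariant averaging step does not increase the energy», as the form inequality `Qfᵀ H Qf ≤ H′` (PART 18) or up to a FACTOR `(1 + ε)·H′` (PART 18
§6).  With a background of non-zero curvature neither shape is the right one: the coarse covariant difference of a transported block average equals
the block average of transported chains of fine covariant differences PLUS a holonomy defect `(V − 1)·u` (the loop «block contour, coarse bond, block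
contour back, fine chain back» has holonomy `V ≠ 1`), and `(V − 1)·u` is controlled by the FIELD, not by its differences.  The honest with-background
stability shape is therefore (STAB-ε,δ): `Qfᵀ H Qf ≤ (1 + ε)·H′ + δ·G` with `G` a mass (Gram) form at the finer level and `δ = O(‖V − 1‖²)` — this is
what the companion PART 22 (`DerivativeRateTransferJensen`) PROVES for transported block averagings with orthogonal transporters.  THIS FILE threads
that shape through the Loewner reduction of PARTs 15 ∕ 18: the composite effective forms still increase up to the slack
`ε·𝒮′ + δ·ℋ′ᵀGℋ′` (`ℋ′` = the finer minimiser map), so the entry one-step rate survives with the slack entering ADDITIVELY, multiplied by the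
k-uniform size `B` of the effective forms and the k-uniform `G`-MASS `N` of the unit-source minimisers `|(ℋ′ᵀGℋ′)_{ab}| ≤ N` (for `G = 1`: the `ℓ²`
mass of `ℋ′e_y`, a regularity datum of the (H2) class — bounded bumps).

PRICING HANDLES (asked by gan24-idea-1 g37, W-idea1-g37-1): which printed inequality feeds `ε` and `δ`?  `ε` — NONE: it is the free Peter–Paul
parameter `t > 0` of the split `|a + b|² ≤ (1+t)|a|² + (1+t⁻¹)|b|²` between the chain term and the holonomy defect (PART 22 proves (STAB-ε,δ) for
EVERY `t > 0` with `ε = t`, `δ ∝ 1 + t⁻¹`; the consumer chooses `t = θ^j`-small).  `δ` — NONE AS PRINTED, TO BE PROVED: PART 22 gives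
`δ = (1 + t⁻¹)·w_c·g·κ²` with `κ` the LOOP-HOLONOMY DEFECT `|(V − 1)w| ≤ κ|w|` of the loops «block contour → coarse bond → block contour back →
fine chain back» (a HYPOTHESIS there); feeding `κ` from a small-field bound on the fine plaquette variables is a lattice-Stokes telescoping
(`‖U(∂Σ) − 1‖ ≤ Σ_{p ∈ Σ} ‖U(∂p) − 1‖`, area `O(L²)` plaquettes per loop) — not done in the tree; nearest print: [Bałaban, CMP 98 (1985)] Prop. 1 (51) ∕
Prop. 2 (54) p. 26 (sup-norm stability of averaged plaquette variables with a quadratic slack, `|Ū(∂p) − 1| ≤ α₀L²η² + C₀(α₀L²η²)²`) — a statement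
ABOUT holonomies of the same kind, not the form inequality itself.  `N` (the `G`-mass of unit-source minimisers) — an (H2)-class regularity datum
([CMP 99] Thm 3.1 (3.42)–(3.47) pp. 397–398 is the printed neighbour: uniform bounds WITH background), not bounded here.

WHAT THIS FILE PROVES (0 sorry, 0 `def`, nothing cited; an1's letters `kkt ∕ minOp ∕ effForm` over `ℝ`, fine forms only PSD, bordered matrices
nonsingular):
* §1 `gram_minOp_apply` (`(ℋᵀGℋ)_{ab} = ⟨ℋe_a, G ℋe_b⟩`), `abs_dotProduct_le_of_self_le` (`|⟨v,w⟩| ≤ N` from `⟨v,v⟩, ⟨w,w⟩ ≤ N`),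
  `abs_gram_one_minOp_apply_le` (for `G = 1`: `|(ℋᵀℋ)_{ab}| ≤ N` from the `ℓ²` masses `⟨ℋe_y, ℋe_y⟩ ≤ N`).
* §2 **`effForm_step_posSemidef_of_stabGram`**: (STAB-ε,δ) `Qfᵀ H Qf ≤ (1+ε)H′ + δG` (`Q′ = Q·Qf`) ⟹ `0 ≤ (1+ε)·𝒮′ + δ·ℋ′ᵀGℋ′ − 𝒮`;
  **`abs_effForm_step_le_of_stabGram_of_cons`**: + (CONS ≤ κ) + `|𝒮′_{ab}| ≤ B` + `|(ℋ′ᵀGℋ′)_{ab}| ≤ N` (`0 ≤ ε, δ`) ⟹ `|𝒮′_{ab} − 𝒮_{ab}| ≤ κ + 2εB + 2δN`;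
  `leg_energy_le_of_stabGram_of_cons`: the minimiser leg in energy currency `≤ κ + εB + δN`.
* §3 **`effForm_entry_step_rate_of_stabGram_of_cons`** — THE TOWER END: (STAB-ε_j,δ_j) with `ε_j = cε·θ^j`, `δ_j = cδ·θ^j`, (CONS_{j,y}) `≤ cst·θ^j`,
  k-uniform `B`, `N` ⟹ `|𝒮_{j+1}(a,b) − 𝒮_j(a,b)| ≤ (cst + 2cε·B + 2cδ·N)·θ^j` — SAME exponent, no `θ ≤ 1` needed; `leg_energy_step_rate_of_stabGram_of_cons`.
WHAT IT DOES NOT DO: produce (STAB-ε,δ) for any operator (PART 22 does, for transported block averagings of colour site fields); bound `N` (an (H2)-class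
regularity datum); touch S2 ∕ S2(ii) ∕ the capstone join (PART 19 §4's pattern applies verbatim — ON REQUEST).  SUPPLIER work on route R6 (rank 2,
REDUCTION, no seat; X-A8 ∕ X-C1 not minted); no consumer of record; NEVER «G-an2-4 closed»; NOT (CONV-C), NOT D1, NOT `BetaPertH`, NOT continuum, NOT
Clay.  Records: `HOME/b2b-balaban-gan24-p3/WOODBURY-FIBRE.md` v13.7, `HOME/beta/ROUTES-GAN24.md` v36 §2 R6, `HOME/b2b-balaban-gan24-refuter/PRICING-GAN24.md` v3.33.
-/

noncomputable section

open Set Matrix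

namespace Summit.QuantumFields.BalabanUV.Beta.GAN24.DerivativeRateTransferLoewnerGram

open Literature.MathematicalPhysics.QuantumFieldTheory.Balaban1983to89.Beta.Composition (kkt)
open Literature.MathematicalPhysics.QuantumFieldTheory.Balaban1983to89.Beta.CompositionSingular (effForm minOp minOpL_eq_transpose)
open Summit.QuantumFields.BalabanUV.Beta.GAN24.DerivativeRateTransferLoewnerKKT (abs_apply_le_of_diag_le transpose_eq_of_posSemidef
  mulVec_dotProduct_eq dotProduct_effForm_eq_energy mulVec_minOp dotProduct_effForm_le_trial single_dotProduct_mulVec_single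
  effForm_step_diag_le_cons leg_energy_eq_cons_sub_step)

/-! ## §1 Gram letters: the `G`-mass matrix of the minimiser map -/

section Gram

variable {c ν : Type*} [Fintype c] [Fintype ν] [DecidableEq c] [DecidableEq ν]

omit [DecidableEq ν] in
/-- **`(ℋᵀGℋ)_{ab} = ⟨ℋe_a, G ℋe_b⟩`** — the Gram ∕ mass matrix of the columns of a map `ℋ` in the form `G`. [folklore] -/
theorem gram_minOp_apply (M : Matrix ν c ℝ) (G : Matrix ν ν ℝ) (a b : c) :
    (Mᵀ * G * M) a b = (M *ᵥ Pi.single a 1) ⬝ᵥ (G *ᵥ (M *ᵥ Pi.single b 1)) := by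
  rw [mulVec_dotProduct_eq, mulVec_mulVec, mulVec_mulVec, single_dotProduct, one_mul, Matrix.mulVec_single_one, Matrix.col_apply]

omit [DecidableEq ν] in
/-- **CAUCHY–SCHWARZ FOR THE DOT PRODUCT**: `⟨v,v⟩ ≤ N`, `⟨w,w⟩ ≤ N` ⟹ `|⟨v,w⟩| ≤ N`. [folklore] -/
theorem abs_dotProduct_le_of_self_le {v w : ν → ℝ} {N : ℝ} (hv : v ⬝ᵥ v ≤ N) (hw : w ⬝ᵥ w ≤ N) : |v ⬝ᵥ w| ≤ N := by
  have hN : 0 ≤ N := le_trans (by rw [dotProduct]; exact Finset.sum_nonneg fun i _ => mul_self_nonneg _) hv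
  have hcs : (v ⬝ᵥ w) ^ 2 ≤ (v ⬝ᵥ v) * (w ⬝ᵥ w) := by
    have h := Finset.sum_mul_sq_le_sq_mul_sq Finset.univ v w
    simp only [dotProduct, sq] at h ⊢
    exact h
  have hww : 0 ≤ w ⬝ᵥ w := by rw [dotProduct]; exact Finset.sum_nonneg fun i _ => mul_self_nonneg _
  have h2 : |v ⬝ᵥ w| ^ 2 ≤ N ^ 2 := by
    rw [sq_abs]; exact hcs.trans (by nlinarith [mul_le_mul hv hw hww hN])
  exact (pow_le_pow_iff_left₀ (abs_nonneg _) hN two_ne_zero).mp h2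

/-- **THE `ℓ²` MASS BOUND OF THE MINIMISER COLUMNS BOUNDS THE GRAM MATRIX** (`G = 1`): `⟨ℋe_y, ℋe_y⟩ ≤ N` for all `y` ⟹ `|(ℋᵀℋ)_{ab}| ≤ N`. [folklore] -/
theorem abs_gram_one_minOp_apply_le (M : Matrix ν c ℝ) {N : ℝ} (hN : ∀ y, (M *ᵥ Pi.single y 1) ⬝ᵥ (M *ᵥ Pi.single y 1) ≤ N)
    (a b : c) : |(Mᵀ * (1 : Matrix ν ν ℝ) * M) a b| ≤ N := by
  rw [gram_minOp_apply, Matrix.one_mulVec]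
  exact abs_dotProduct_le_of_self_le (hN a) (hN b)

end Gram

/-! ## §2 Two levels under (STAB-ε,δ): the monotone step up to the Gram slack, the entry bound, the leg -/

section TwoLevels

variable {c ν ν' : Type*} [Fintype c] [Fintype ν] [Fintype ν'] [DecidableEq c] [DecidableEq ν] [DecidableEq ν']
variable {H : Matrix ν ν ℝ} {Q : Matrix c ν ℝ} {H' : Matrix ν' ν' ℝ} {Q' : Matrix c ν' ℝ} {Qf : Matrix ν ν' ℝ} {P : Matrix ν' ν ℝ}
variable {G : Matrix ν' ν' ℝ} {ε δ : ℝ}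

omit [Fintype c] [DecidableEq c] [DecidableEq ν] [DecidableEq ν'] in
/-- the Gram slack is symmetric when the mass form is. [folklore] -/
theorem transpose_gram (hG : Gᵀ = G) (M : Matrix ν' c ℝ) : (Mᵀ * G * M)ᵀ = Mᵀ * G * M := by
  rw [transpose_mul, transpose_mul, transpose_transpose, hG, Matrix.mul_assoc]

/-- **(STAB-ε,δ) ⟹ THE EFFECTIVE FORMS INCREASE UP TO THE GRAM SLACK** [our proof]: fine forms PSD, bordered matrices nonsingular, `Q′ = Q·Qf`,
`Gᵀ = G`, and `Qfᵀ H Qf ≤ (1+ε)·H′ + δ·G` ⟹ `0 ≤ (1+ε)·𝒮(H′,Q′) + δ·ℋ′ᵀGℋ′ − 𝒮(H,Q)` (`ℋ′ = minOp H′ Q′`).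
At one vector: `⟨v,𝒮v⟩ ≤ ⟨Qfℋ′v, H Qfℋ′v⟩ ≤ (1+ε)⟨ℋ′v, H′ℋ′v⟩ + δ⟨ℋ′v, Gℋ′v⟩ = (1+ε)⟨v,𝒮′v⟩ + δ⟨v, ℋ′ᵀGℋ′v⟩`. -/
theorem effForm_step_posSemidef_of_stabGram (hH : H.PosSemidef) (hH' : H'.PosSemidef) (h : IsUnit (kkt H Q).det)
    (h' : IsUnit (kkt H' Q').det) (hcomp : Q' = Q * Qf) (hG : Gᵀ = G)
    (hstab : ((1 + ε) • H' + δ • G - Qfᵀ * H * Qf).PosSemidef) :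
    ((1 + ε) • effForm H' Q' + δ • ((minOp H' Q')ᵀ * G * minOp H' Q') - effForm H Q).PosSemidef := by
  have hS : (effForm H Q)ᵀ = effForm H Q := (minOpL_eq_transpose H Q (transpose_eq_of_posSemidef hH)).2.2
  have hS' : (effForm H' Q')ᵀ = effForm H' Q' := (minOpL_eq_transpose H' Q' (transpose_eq_of_posSemidef hH')).2.2
  refine PosSemidef.of_dotProduct_mulVec_nonneg ?_ fun v => ?_
  · rw [Matrix.IsHermitian, Matrix.conjTranspose_eq_transpose_of_trivial, transpose_sub, transpose_add, transpose_smul, transpose_smul,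
      hS, hS', transpose_gram hG]
  · simp only [star_trivial, sub_mulVec, add_mulVec, dotProduct_sub, dotProduct_add, sub_nonneg, smul_mulVec, dotProduct_smul,
      smul_eq_mul]
    set u' : ν' → ℝ := minOp H' Q' *ᵥ v with hu'
    have hadm : Q *ᵥ (Qf *ᵥ u') = v := by rw [mulVec_mulVec, ← hcomp]; exact mulVec_minOp h' v
    have h1 := dotProduct_effForm_le_trial hH h hadm
    have h2 := hstab.dotProduct_mulVec_nonneg u'
    simp only [star_trivial, sub_mulVec, add_mulVec, dotProduct_sub, dotProduct_add, sub_nonneg, smul_mulVec, dotProduct_smul,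
      smul_eq_mul] at h2
    have h3 : v ⬝ᵥ (((minOp H' Q')ᵀ * G * minOp H' Q') *ᵥ v) = u' ⬝ᵥ (G *ᵥ u') := by
      rw [hu', mulVec_dotProduct_eq, mulVec_mulVec, mulVec_mulVec, Matrix.mul_assoc]
    rw [dotProduct_effForm_eq_energy h' v, h3, ← hu']
    calc v ⬝ᵥ (effForm H Q *ᵥ v) ≤ (Qf *ᵥ u') ⬝ᵥ (H *ᵥ (Qf *ᵥ u')) := h1
      _ = u' ⬝ᵥ ((Qfᵀ * H * Qf) *ᵥ u') := by rw [mulVec_dotProduct_eq, mulVec_mulVec, mulVec_mulVec, Matrix.mul_assoc]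
      _ ≤ (1 + ε) * (u' ⬝ᵥ (H' *ᵥ u')) + δ * (u' ⬝ᵥ (G *ᵥ u')) := h2

/-- **THE TWO-LEVEL ENTRY BOUND UNDER (STAB-ε,δ) + (CONS)** [our proof]: with `Q′P = Q`, (CONS ≤ κ) on the unit-source minimisers, k-uniform
bounds `|𝒮′_{ab}| ≤ B` and `|(ℋ′ᵀGℋ′)_{ab}| ≤ N`, `0 ≤ ε`, `0 ≤ δ` ⟹ `|𝒮′_{ab} − 𝒮_{ab}| ≤ κ + 2ε·B + 2δ·N`.  The PSD matrix
`D = (1+ε)𝒮′ + δℋ′ᵀGℋ′ − 𝒮` has diagonal `(𝒮′_{yy} − 𝒮_{yy}) + ε𝒮′_{yy} + δ(ℋ′ᵀGℋ′)_{yy} ≤ κ + εB + δN`, hence such entries;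
`𝒮′_{ab} − 𝒮_{ab} = D_{ab} − ε𝒮′_{ab} − δ(ℋ′ᵀGℋ′)_{ab}`. -/
theorem abs_effForm_step_le_of_stabGram_of_cons (hH : H.PosSemidef) (hH' : H'.PosSemidef) (h : IsUnit (kkt H Q).det)
    (h' : IsUnit (kkt H' Q').det) (hcomp : Q' = Q * Qf) (hPQ : Q' * P = Q) (hG : Gᵀ = G) {κ B N : ℝ} (hε : 0 ≤ ε) (hδ : 0 ≤ δ)
    (hstab : ((1 + ε) • H' + δ • G - Qfᵀ * H * Qf).PosSemidef)
    (hcons : ∀ y, (minOp H Q *ᵥ Pi.single y 1) ⬝ᵥ ((Pᵀ * H' * P - H) *ᵥ (minOp H Q *ᵥ Pi.single y 1)) ≤ κ)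
    (hB : ∀ a b, |effForm H' Q' a b| ≤ B) (hN : ∀ a b, |((minOp H' Q')ᵀ * G * minOp H' Q') a b| ≤ N) (a b : c) :
    |effForm H' Q' a b - effForm H Q a b| ≤ κ + 2 * ε * B + 2 * δ * N := by
  set M : Matrix c c ℝ := (minOp H' Q')ᵀ * G * minOp H' Q' with hM
  have hD := effForm_step_posSemidef_of_stabGram hH hH' h h' hcomp hG hstab
  rw [← hM] at hD
  have hdiag : ∀ y, ((1 + ε) • effForm H' Q' + δ • M - effForm H Q) y y ≤ κ + ε * B + δ * N := fun y => by
    have hstep := effForm_step_diag_le_cons hH' h h' hPQ y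
    have hy := (abs_le.mp (hB y y)).2
    have hMy := (abs_le.mp (hN y y)).2
    rw [Matrix.sub_apply, Matrix.add_apply, Matrix.smul_apply, Matrix.smul_apply, smul_eq_mul, smul_eq_mul]
    nlinarith [hcons y, hstep, mul_le_mul_of_nonneg_left hy hε, mul_le_mul_of_nonneg_left hMy hδ]
  have hDab := abs_apply_le_of_diag_le hD hdiag a b
  rw [Matrix.sub_apply, Matrix.add_apply, Matrix.smul_apply, Matrix.smul_apply, smul_eq_mul, smul_eq_mul] at hDab
  have hε' : |ε * effForm H' Q' a b| ≤ ε * B := by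
    rw [abs_mul, abs_of_nonneg hε]; exact mul_le_mul_of_nonneg_left (hB a b) hε
  have hδ' : |δ * M a b| ≤ δ * N := by
    rw [abs_mul, abs_of_nonneg hδ]; exact mul_le_mul_of_nonneg_left (hN a b) hδ
  calc |effForm H' Q' a b - effForm H Q a b|
      = |((1 + ε) * effForm H' Q' a b + δ * M a b - effForm H Q a b) - ε * effForm H' Q' a b - δ * M a b| := by ring_nf
    _ ≤ |(1 + ε) * effForm H' Q' a b + δ * M a b - effForm H Q a b - ε * effForm H' Q' a b| + |δ * M a b| := abs_sub _ _
    _ ≤ |(1 + ε) * effForm H' Q' a b + δ * M a b - effForm H Q a b| + |ε * effForm H' Q' a b| + |δ * M a b| :=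
        add_le_add (abs_sub _ _) le_rfl
    _ ≤ (κ + ε * B + δ * N) + ε * B + δ * N := add_le_add (add_le_add hDab hε') hδ'
    _ = κ + 2 * ε * B + 2 * δ * N := by ring

/-- **THE MINIMISER LEG IN ENERGY CURRENCY UNDER (STAB-ε,δ)** [our proof]: `H′` PSD, `Q′P = Q` ⟹
`⟨Pℋe_y − ℋ′e_y, H′(Pℋe_y − ℋ′e_y)⟩ ≤ κ + ε·B + δ·N` — PART 18's exact leg split (leg = (CONS) − step) with the step now bounded BELOW by
`−(ε𝒮′_{yy} + δ(ℋ′ᵀGℋ′)_{yy})` instead of `0`. -/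
theorem leg_energy_le_of_stabGram_of_cons (hH : H.PosSemidef) (hH' : H'.PosSemidef) (h : IsUnit (kkt H Q).det)
    (h' : IsUnit (kkt H' Q').det) (hcomp : Q' = Q * Qf) (hPQ : Q' * P = Q) (hG : Gᵀ = G) {κ B N : ℝ} (hε : 0 ≤ ε) (hδ : 0 ≤ δ)
    (hstab : ((1 + ε) • H' + δ • G - Qfᵀ * H * Qf).PosSemidef)
    (hcons : ∀ y, (minOp H Q *ᵥ Pi.single y 1) ⬝ᵥ ((Pᵀ * H' * P - H) *ᵥ (minOp H Q *ᵥ Pi.single y 1)) ≤ κ)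
    (hB : ∀ a b, |effForm H' Q' a b| ≤ B) (hN : ∀ a b, |((minOp H' Q')ᵀ * G * minOp H' Q') a b| ≤ N) (y : c) :
    (P *ᵥ (minOp H Q *ᵥ Pi.single y 1) - minOp H' Q' *ᵥ Pi.single y 1) ⬝ᵥ
        (H' *ᵥ (P *ᵥ (minOp H Q *ᵥ Pi.single y 1) - minOp H' Q' *ᵥ Pi.single y 1)) ≤ κ + ε * B + δ * N := by
  rw [leg_energy_eq_cons_sub_step (transpose_eq_of_posSemidef hH') h h' hPQ y]
  have hD := (effForm_step_posSemidef_of_stabGram hH hH' h h' hcomp hG hstab).diag_nonneg (i := y)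
  rw [Matrix.sub_apply, Matrix.add_apply, Matrix.smul_apply, Matrix.smul_apply, smul_eq_mul, smul_eq_mul] at hD
  have hy := (abs_le.mp (hB y y)).2
  have hMy := (abs_le.mp (hN y y)).2
  nlinarith [hcons y, mul_le_mul_of_nonneg_left hy hε, mul_le_mul_of_nonneg_left hMy hδ]

end TwoLevels

/-! ## §3 The tower END under (STAB-ε_j,δ_j) with geometric slacks -/

section Tower

variable {c : Type*} [Fintype c] [DecidableEq c]
variable {ι : ℕ → Type*} [∀ j, Fintype (ι j)] [∀ j, DecidableEq (ι j)]
variable {H : ∀ j, Matrix (ι j) (ι j) ℝ} {Qf : ∀ j, Matrix (ι j) (ι (j + 1)) ℝ} {Qc : ∀ j, Matrix c (ι j) ℝ}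
variable {P : ∀ j, Matrix (ι (j + 1)) (ι j) ℝ} {G : ∀ j, Matrix (ι j) (ι j) ℝ} {cst cε cδ θ B N : ℝ}

/-- **`effForm_entry_step_rate_of_stabGram_of_cons` — THE TOWER END UNDER THE ADDITIVE GRAM SLACK** [our proof]: PSD fine forms `H j`, nonsingular
bordered matrices, `Qc (j+1) = Qc j · Qf j`, `Qc (j+1) · P j = Qc j`, symmetric mass forms `G j`; (STAB-ε_j,δ_j)
`(Qf j)ᵀ H_j (Qf j) ≤ (1 + cε·θ^j)·H_{j+1} + (cδ·θ^j)·G_{j+1}`, (CONS_{j,y}) `≤ cst·θ^j`, k-uniform `|𝒮_j(a,b)| ≤ B` and `|(ℋ_jᵀ G_j ℋ_j)_{ab}| ≤ N`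
(`0 ≤ cε, cδ`, `0 ≤ θ`) ⟹ `|𝒮_{j+1}(a,b) − 𝒮_j(a,b)| ≤ (cst + 2cε·B + 2cδ·N)·θ^j` for all `j, a, b` — the curvature slack enters the CONSTANT only. -/
theorem effForm_entry_step_rate_of_stabGram_of_cons (hH : ∀ j, (H j).PosSemidef) (hk : ∀ j, IsUnit (kkt (H j) (Qc j)).det)
    (hcomp : ∀ j, Qc (j + 1) = Qc j * Qf j) (hPQ : ∀ j, Qc (j + 1) * P j = Qc j) (hG : ∀ j, (G j)ᵀ = G j)
    (hcε : 0 ≤ cε) (hcδ : 0 ≤ cδ) (hθ0 : 0 ≤ θ)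
    (hstab : ∀ j, ((1 + cε * θ ^ j) • H (j + 1) + (cδ * θ ^ j) • G (j + 1) - (Qf j)ᵀ * H j * Qf j).PosSemidef)
    (hcons : ∀ j (y : c), (minOp (H j) (Qc j) *ᵥ Pi.single y 1) ⬝ᵥ
        (((P j)ᵀ * H (j + 1) * P j - H j) *ᵥ (minOp (H j) (Qc j) *ᵥ Pi.single y 1)) ≤ cst * θ ^ j)
    (hB : ∀ j a b, |effForm (H j) (Qc j) a b| ≤ B) (hN : ∀ j a b, |((minOp (H j) (Qc j))ᵀ * G j * minOp (H j) (Qc j)) a b| ≤ N) :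
    ∀ j (a b : c), |effForm (H (j + 1)) (Qc (j + 1)) a b - effForm (H j) (Qc j) a b| ≤ (cst + 2 * cε * B + 2 * cδ * N) * θ ^ j := by
  intro j a b
  have hθj : 0 ≤ θ ^ j := pow_nonneg hθ0 j
  have h := abs_effForm_step_le_of_stabGram_of_cons (hH j) (hH (j + 1)) (hk j) (hk (j + 1)) (hcomp j) (hPQ j) (hG (j + 1))
    (mul_nonneg hcε hθj) (mul_nonneg hcδ hθj) (hstab j) (hcons j) (fun a b => hB (j + 1) a b) (fun a b => hN (j + 1) a b) a b
  refine h.trans (le_of_eq ?_)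
  ring

/-- **`leg_energy_step_rate_of_stabGram_of_cons` — THE LEGS IN ENERGY CURRENCY FROM THE SAME DATUM** [our proof]: under the same hypotheses
`⟨P_jℋ_j e_y − ℋ_{j+1}e_y, H_{j+1}(P_jℋ_j e_y − ℋ_{j+1}e_y)⟩ ≤ (cst + cε·B + cδ·N)·θ^j` for all `j, y`. -/
theorem leg_energy_step_rate_of_stabGram_of_cons (hH : ∀ j, (H j).PosSemidef) (hk : ∀ j, IsUnit (kkt (H j) (Qc j)).det)
    (hcomp : ∀ j, Qc (j + 1) = Qc j * Qf j) (hPQ : ∀ j, Qc (j + 1) * P j = Qc j) (hG : ∀ j, (G j)ᵀ = G j)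
    (hcε : 0 ≤ cε) (hcδ : 0 ≤ cδ) (hθ0 : 0 ≤ θ)
    (hstab : ∀ j, ((1 + cε * θ ^ j) • H (j + 1) + (cδ * θ ^ j) • G (j + 1) - (Qf j)ᵀ * H j * Qf j).PosSemidef)
    (hcons : ∀ j (y : c), (minOp (H j) (Qc j) *ᵥ Pi.single y 1) ⬝ᵥ
        (((P j)ᵀ * H (j + 1) * P j - H j) *ᵥ (minOp (H j) (Qc j) *ᵥ Pi.single y 1)) ≤ cst * θ ^ j)
    (hB : ∀ j a b, |effForm (H j) (Qc j) a b| ≤ B) (hN : ∀ j a b, |((minOp (H j) (Qc j))ᵀ * G j * minOp (H j) (Qc j)) a b| ≤ N) :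
    ∀ j (y : c), (P j *ᵥ (minOp (H j) (Qc j) *ᵥ Pi.single y 1) - minOp (H (j + 1)) (Qc (j + 1)) *ᵥ Pi.single y 1) ⬝ᵥ
        (H (j + 1) *ᵥ (P j *ᵥ (minOp (H j) (Qc j) *ᵥ Pi.single y 1) - minOp (H (j + 1)) (Qc (j + 1)) *ᵥ Pi.single y 1)) ≤
      (cst + cε * B + cδ * N) * θ ^ j := by
  intro j y
  have hθj : 0 ≤ θ ^ j := pow_nonneg hθ0 j
  have h := leg_energy_le_of_stabGram_of_cons (hH j) (hH (j + 1)) (hk j) (hk (j + 1)) (hcomp j) (hPQ j) (hG (j + 1))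
    (mul_nonneg hcε hθj) (mul_nonneg hcδ hθj) (hstab j) (hcons j) (fun a b => hB (j + 1) a b) (fun a b => hN (j + 1) a b) y
  refine h.trans (le_of_eq ?_)
  ring

end Tower

end Summit.QuantumFields.BalabanUV.Beta.GAN24.DerivativeRateTransferLoewnerGram

end
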